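import Literature.MathematicalPhysics.QuantumFieldTheory.Balaban1983to89.Node00.TkWeightsOfRecord

/-!
# NODE 00 — DEFINER ₇b (T-side), FILE 12a″: the 𝐓-WEIGHTS OF RECORD WITH PRINT'S `ζ` — NO regularity factor on `Ω^c_{j+1}`
# (director-ym LINE №154 FINDING №7 «TLaw₁₃ at step 0» ∕ LINE №155 WORD 1; dag-n11-d `not_tLaw₁₃_zero`; def-T LOCATED-7, pub-ymgap INBOX l.18227)

Cell `pub-ymgap`, NODE 00, definer seat `pub-ymgap-node00-def-T` (g15).  [III] = [Balaban1988Convergent] (CMP **119** (1988) 243–285).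
A SIBLING of FILE 12a `Node00/TkWeightsOfRecord.lean` (UNTOUCHED, gate5 D-0009): same §1–§3 factors and residual datum BY NAME, a second weight family.

WHY THIS FILE (FINDING №7, located).  12a pinned `ζ_j(Y) := ζ0_j(Y) · χreg_j(Y)` (`zetaWt`, FILE 12a :298–300) with `χreg_j(Y)` = the characteristic
function «`(ω j).1` is `(cR·ε_j)`-regular on EVERY plaquette of `T^{(j)}` touching `Y`» (`chiRegW`, :210), and 11a feeds generation `j` of `𝐓_k(s′)` at
`Y = Ω_{j+1}(s′)ᶜ` (`genDataOfRecord`, FILE 11a :563).  At `j = 0` this demands the retained fine field `U = V₀` regular on ALL of `Ω₁(s′)ᶜ` — including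
print's step-0 large-field region `P₀` and the χ₁-cubes of `P₁ ∪ Q₁`, which (3.5) places inside `Ω₁ᶜ`.  PRINT does not: p.246 (1.1) decomposes unity
over the large-field regions `P₀` of the ORIGINAL field with factors `χ(sup_{p∈□}|U(∂p) − 1| ≥ ε₀)` and NO further condition there; p.248 (1.10)–(1.11):
`Ω₁ᶜ ⊇ P₀^∼ ∪ …`, «a distance between Ω₁ and the union of the large field regions is at least 2LMR₁», and «the factor ζ(Ω₁ᶜ) is defined by ALL
characteristic functions and gauge fixing exponential factors localized in Ω₁ᶜ, and resummed over all admissible P₀, P′₁, Q₁» — print's `ζ` CONTAINS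
the large-field factors and is supported on rough `U`; the regularity Theorem 1 [15] reads («we assume that the field V_{j−1} is regular on Γ_{j−1}»,
p.256) lives on the part of the determining set the backgrounds read — p.255 «the domain Ω₁, or rather a small neighborhood of Ω₁ including a layer of
M₁-cubes, is called its support» — where it holds FOR FREE by (1.10)'s margin.  With 12a's extra factor every term of the (S1ᵀ) sum dies on dag-n11-d's
central-rough event while `T[ρ₀] > 0` there: `not_tLaw₁₃_zero` at EVERY `θ` (`Thm/BalabanUVNodesN11NoTLawAtAnyRegularity.lean`).

WHAT THIS FILE TYPES (definitions + unfolding faces; nothing of Bałaban asserted):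
* §1 `zetaWtP Z j Y := Z.ζ0 j Y` — print's `ζ_j(Y)`: the residual's resummed characteristic functions, NO regularity factor; the located comparison
  `zetaWt_eq_zetaWtP_mul_chiRegW` (12a's `ζ` = this one times `χreg`, `rfl`) and `zetaWtP_eq_zetaWt_of_chiRegW_eq_one`.
* §2 `tkWeightsOfRecordP Z : TkWeights F N V p.K` — `ζ := zetaWtP`, `quad := Z.quad`, `chiA := chiAW` (12a's (3.21) A-side factors VERBATIM, same
  decl); unfolding faces; `tkWeightsOfRecordP_chiA_eq ∕ _quad_eq ∕ _w_eq` (the A-side of 12a and 12a″ coincide, `rfl`); `tkWeightsOfRecordP_laws` (11a's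
  displayed laws under `Z.Laws`, PROVED).
* §3 THE REGULARITY THE BACKGROUNDS READ, AS A DISPLAYED LAW OF THE RESIDUAL instead of a factor: `TkResidualW.RegOn Γr Z` := «`ζ0_j(Y)(ω) ≠ 0` ⇒
  `(ω j).1` is `(cR·ε_j)`-regular on the plaquettes touching `Γr j Y ⊆ Y`» for a READING-REGION SELECTOR `Γr` (print's: `readSelOfSeq Ω₀ Ω j Y := Y ∩ Ω_j` with `Ω_0 := Ω₀` the support domain — at `Y = Ω^c_{j+1}` this is
  `Λ₀ = Ω₀∖Ω₁` for `j = 0` (`readSelOfSeq_zero_compl`) and r12's `Γ_j = gammaRegion Ω n j` for `1 ≤ j < n` (`readSelOfSeq_compl_eq_gammaRegion`); 12a's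
  old factor = the selector `fun _ Y => Y`); `RegOn.mono`, `RegOn.readSel_of_id`; the support readings `plaqSmallOn_of_zetaWtP_ne_zero` and — at
  `Y = Ω^c_{j+1}` — `plaqSmallOn_readOn_of_zetaP_ne_zero` (the T-half of def-R's JOINT statement RFACE-11d, now relative to `Γr`: whoever pins `Z` — K0b's
  residuals of record — discharges `RegOn (readSelOfSeq Ω₀ Ω)` from the (3.2) small-field factors INSIDE `ζ0` ([III] p.264, p.267: the smallness of the
  new variables on `Γ_j` is a CONSEQUENCE of the characteristic functions, not an extra factor); the class side re-ranges its scale-0 clauses to the same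
  `Ω₀` — node00-def-R's FILE 22′ `LargeFieldBackgroundCoPOfRecord`, not this file).
WHICH FORM WAS TYPED (director-ym №161 (3)(b)): the «ζ0-only» form at EVERY generation `j` — NOT the «`j = 0 ↦ 1` exemption + Γ-region factor for
`j ≥ 1`» form.  Why it reproduces both print loci: (1.11) p.248 — `zetaWtP Z 0 Ω₁ᶜ = ζ0_0(Ω₁ᶜ)` IS the resummation over all admissible `(P₀, P′₁, Q₁)`
INCLUDING the `P₀ ≠ ∅` terms (the pinned residual sums over the large-field labels; no factor of this file can delete a term); p.264 ∕ p.267 (the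
«consequence-cut» for `j ≥ 1`, ref-H WATCH-8) — a CONSEQUENCE is a theorem about `ζ0`, displayed here as `RegOn (readSelOfSeq Ω₀ Ω)` whose `j ≥ 1`
regions ARE the `Γ_j` (`readSelOfSeq_compl_eq_gammaRegion`), never all of `Ω^c_{j+1}`; a multiplicative Γ-region factor would re-impose at `j ≥ 1`, on
towers rough OUTSIDE `Ω_j` (which 11a's generation `j` still carries: `sV = bondsIn j Ω^c_{j+1}`), the same cut FINDING №7 removes at `j = 0`.
HONEST SCOPE.  Definitions of record + bookkeeping PROVED by unfolding.  NOT ASSERTED: anything of Bałaban ([III] Thm 2, [15] Thm 1, the bounds on `ζ`);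
`RegOn` is a DISPLAYED hypothesis, never assumed to hold.  Counts UNMOVED (typed 28∕28 · discharged 5∕28); one finite `T⁴` torus at fixed `ε = L^{−K}`;
not continuum ∕ ℝ⁴ ∕ OS ∕ mass-gap ∕ Clay.  No `sorry`, no `axiom`, no `instance`, no `notation`.
-/

noncomputable section

open MeasureTheory
open scoped BigOperators

namespace Literature.MathematicalPhysics.QuantumFieldTheory.Balaban1983to89.Node00

open T4Continuum
open B15DeterminingSets B15Eq112TorusCover B14DomainGeom B8Eq17ClassAkV1
open Tk

/-! ## §1  Print's `ζ_j(Y)`: the residual's resummed characteristic functions, no regularity factor -/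

section Zeta

variable (F : T4Family) (N : ℕ) (V : Type) (p : B12.RunParams)

/-- **PRINT'S `ζ_j(Y)` OF RECORD** (12a″): the residual part ALONE — p.248 (1.11) «the factor ζ(Ω₁ᶜ) is defined by all characteristic functions and gauge
fixing exponential factors localized in Ω₁ᶜ, and resummed over all admissible P₀, P′₁, Q₁», p.267 «a function ζ(Ω^c_{k+1}) which is a sum of products of
characteristic functions and the functions connected with gauge fixing terms» — WITHOUT 12a's regularity factor `chiRegW … j Y` on `Y`.
[cite: Balaban1988Convergent, (1.11) p.248, (2.21) p.258, p.267] -/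
def zetaWtP (Z : TkResidualW F N V p.K) (j : ℕ) (Y : Set (Site (F.P p.K) 0)) (ω : MultiCfg (F.P p.K) (SU N) V) : ℝ :=
  Z.ζ0 j Y ω

variable {F N V p}

/-- Unfolding (`rfl`). [cite: Balaban1988Convergent, (2.21) p.258 (bookkeeping)] -/
theorem zetaWtP_apply (Z : TkResidualW F N V p.K) (j : ℕ) (Y : Set (Site (F.P p.K) 0)) (ω : MultiCfg (F.P p.K) (SU N) V) :
    zetaWtP F N V p Z j Y ω = Z.ζ0 j Y ω := rfl

/-- `0 ≤ ζ_j(Y)` under the residual law. [cite: Balaban1988Convergent, p.267 (bookkeeping)] -/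
theorem zetaWtP_nonneg {Z : TkResidualW F N V p.K} (hZ : Z.Laws) (j : ℕ) (Y : Set (Site (F.P p.K) 0)) (ω : MultiCfg (F.P p.K) (SU N) V) :
    0 ≤ zetaWtP F N V p Z j Y ω :=
  hZ.zeta0_nonneg j Y ω

variable [NeZero N] {ν : Stage7Numerics} {cR : ℝ} {g : ℕ → ℝ}

/-- **THE LOCATED COMPARISON** (FINDING №7): 12a's `ζ_j(Y)` IS print's `ζ_j(Y)` TIMES the regularity factor `χreg_j(Y)` on ALL of `Y` (`rfl`).
[cite: Balaban1988Convergent, (2.10) p.256, (1.11) p.248] -/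
theorem zetaWt_eq_zetaWtP_mul_chiRegW (Z : TkResidualW F N V p.K) (j : ℕ) (Y : Set (Site (F.P p.K) 0)) (ω : MultiCfg (F.P p.K) (SU N) V) :
    zetaWt F N V ν cR p g Z j Y ω = zetaWtP F N V p Z j Y ω * chiRegW F N V ν cR p g j Y ω := rfl

/-- Where 12a's regularity factor is `1`, the two `ζ`'s agree. [cite: Balaban1988Convergent, (2.10) p.256 (bookkeeping)] -/
theorem zetaWtP_eq_zetaWt_of_chiRegW_eq_one {Z : TkResidualW F N V p.K} {j : ℕ} {Y : Set (Site (F.P p.K) 0)} {ω : MultiCfg (F.P p.K) (SU N) V}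
    (h : chiRegW F N V ν cR p g j Y ω = 1) : zetaWtP F N V p Z j Y ω = zetaWt F N V ν cR p g Z j Y ω := by
  rw [zetaWt_eq_zetaWtP_mul_chiRegW, h, mul_one]

/-- `ζ_j(Y)` of 12a is dominated by print's (`0 ≤ χreg ≤ 1`, `ζ0 ≥ 0`). [cite: Balaban1988Convergent, (2.10) p.256 (bookkeeping)] -/
theorem zetaWt_le_zetaWtP {Z : TkResidualW F N V p.K} (hZ : Z.Laws) (j : ℕ) (Y : Set (Site (F.P p.K) 0)) (ω : MultiCfg (F.P p.K) (SU N) V) :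
    zetaWt F N V ν cR p g Z j Y ω ≤ zetaWtP F N V p Z j Y ω := by
  rw [zetaWt_eq_zetaWtP_mul_chiRegW]
  exact mul_le_of_le_one_right (zetaWtP_nonneg hZ j Y ω) (chiRegW_le_one Y ω)

/-- A non-zero 12a-`ζ` forces a non-zero print-`ζ` (the converse is the located defect: it FAILS at rough retained fields).
[cite: Balaban1988Convergent, (1.11) p.248 (bookkeeping)] -/
theorem zetaWtP_ne_zero_of_zetaWt_ne_zero {Z : TkResidualW F N V p.K} {j : ℕ} {Y : Set (Site (F.P p.K) 0)} {ω : MultiCfg (F.P p.K) (SU N) V}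
    (h : zetaWt F N V ν cR p g Z j Y ω ≠ 0) : zetaWtP F N V p Z j Y ω ≠ 0 :=
  left_ne_zero_of_mul (zetaWt_eq_zetaWtP_mul_chiRegW Z j Y ω ▸ h)

end Zeta

/-! ## §2  The 𝐓-weights of record with print's `ζ` -/

section Weights

variable (F : T4Family) (N : ℕ) [NeZero N] (V : Type) [SeminormedAddCommGroup V]
variable (ν : Stage7Numerics) (A₁ cR : ℝ) (p : B12.RunParams) (g : ℕ → ℝ)

/-- **THE 𝐓-WEIGHTS OF RECORD WITH PRINT'S `ζ`** (12a″): 11a's datum `TkWeights F N V p.K` with `ζ := zetaWtP` (NO regularity factor), `quad` the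
residual's and `chiA := chiAW` — 12a's (3.21) A-side factors, the same declaration. [cite: Balaban1988Convergent, (2.21) p.258, (3.21) p.269, (1.11) p.248] -/
def tkWeightsOfRecordP (Z : TkResidualW F N V p.K) : TkWeights F N V p.K where
  ζ := zetaWtP F N V p Z
  quad := Z.quad
  chiA := chiAW F N V ν A₁ p g

variable {F N V ν A₁ cR p g}

/-- Unfolding of the `ζ`-field (`rfl`). [cite: Balaban1988Convergent, (2.21) p.258 (bookkeeping)] -/
@[simp] theorem tkWeightsOfRecordP_ζ (Z : TkResidualW F N V p.K) : (tkWeightsOfRecordP F N V ν A₁ p g Z).ζ = zetaWtP F N V p Z := rfl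

/-- Unfolding of the `quad`-field (`rfl`). [cite: Balaban1988Convergent, (2.21) p.258 (bookkeeping)] -/
@[simp] theorem tkWeightsOfRecordP_quad (Z : TkResidualW F N V p.K) : (tkWeightsOfRecordP F N V ν A₁ p g Z).quad = Z.quad := rfl

/-- Unfolding of the `chiA`-field (`rfl`). [cite: Balaban1988Convergent, (3.21) p.269 (bookkeeping)] -/
@[simp] theorem tkWeightsOfRecordP_chiA (Z : TkResidualW F N V p.K) : (tkWeightsOfRecordP F N V ν A₁ p g Z).chiA = chiAW F N V ν A₁ p g := rfl

/-- THE A-SIDE IS 12a's: `chiA` of 12a″ = `chiA` of 12a (`rfl`; the located change is on `ζ` only). [cite: Balaban1988Convergent, (3.21) p.269 (bookkeeping)] -/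
theorem tkWeightsOfRecordP_chiA_eq (Z : TkResidualW F N V p.K) :
    (tkWeightsOfRecordP F N V ν A₁ p g Z).chiA = (tkWeightsOfRecord F N V ν A₁ cR p g Z).chiA := rfl

/-- … and so is `quad` (`rfl`). [cite: Balaban1988Convergent, (2.21) p.258 (bookkeeping)] -/
theorem tkWeightsOfRecordP_quad_eq (Z : TkResidualW F N V p.K) :
    (tkWeightsOfRecordP F N V ν A₁ p g Z).quad = (tkWeightsOfRecord F N V ν A₁ cR p g Z).quad := rfl

/-- … hence the A-weights `w = χ·exp(−½·quad)` of 11a coincide (`rfl`). [cite: Balaban1988Convergent, (2.21) p.258 (bookkeeping)] -/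
theorem tkWeightsOfRecordP_w_eq (Z : TkResidualW F N V p.K) (j : ℕ) (Λ' Y S : Set (Site (F.P p.K) 0)) :
    (tkWeightsOfRecordP F N V ν A₁ p g Z).w j Λ' Y S = (tkWeightsOfRecord F N V ν A₁ cR p g Z).w j Λ' Y S := rfl

/-- THE `ζ`-SIDE COMPARISON at the level of the weight data: 12a's `ζ` = 12a″'s `ζ` times `χreg` (`rfl`). [cite: Balaban1988Convergent, (2.10) p.256, (1.11) p.248] -/
theorem tkWeightsOfRecord_ζ_eq_mul (Z : TkResidualW F N V p.K) (j : ℕ) (Y : Set (Site (F.P p.K) 0)) (ω : MultiCfg (F.P p.K) (SU N) V) :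
    (tkWeightsOfRecord F N V ν A₁ cR p g Z).ζ j Y ω = (tkWeightsOfRecordP F N V ν A₁ p g Z).ζ j Y ω * chiRegW F N V ν cR p g j Y ω := rfl

/-- **11a's DISPLAYED LAWS HOLD AT THE 12a″ WEIGHTS** under the residual law (`ζ ≥ 0`, `0 ≤ χ ≤ 1` — PROVED). [cite: Balaban1988Convergent, (2.21) p.258] -/
theorem tkWeightsOfRecordP_laws {Z : TkResidualW F N V p.K} (hZ : Z.Laws) : (tkWeightsOfRecordP F N V ν A₁ p g Z).Laws where
  zeta_nonneg := zetaWtP_nonneg hZ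
  chiA_nonneg := chiAW_nonneg
  chiA_le_one := chiAW_le_one

end Weights

/-! ## §3  The regularity the backgrounds read, as a displayed law of the residual on a reading region -/

section Reading

/-- **THE READING-REGION LAW OF THE RESIDUAL** for a selector `Γr` (`Γr j Y` = the part of `Y` on which the scale-`j` backgrounds read the retained
variables): a non-zero `ζ0_j(Y)(ω)` forces `(ω j).1` to be `(cR·ε_j)`-regular on the plaquettes of `T^{(j)}` touching `Γr j Y` — p.256 «we assume that the
field V_{j−1} is regular on Γ_{j−1} in the sense that |∂V_{j−1} − 1| < O(L²)ε_{j−1}», read WHERE PRINT READS IT (p.255: the support of the determining set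
is «Ω₁ … including a layer of M₁-cubes»).  DISPLAYED, never assumed; discharged by whoever pins `Z` (from the (3.2) small-field factors off `P_{j+1}` and
(1.10)'s `2LMR₁` margin).  12a's factor corresponds to the selector `Γr j Y = Y`. [cite: Balaban1988Convergent, (2.10) p.256, p.255, (1.10) p.248] -/
def TkResidualW.RegOn (F : T4Family) (N : ℕ) [NeZero N] (V : Type) (ν : Stage7Numerics) (cR : ℝ) (p : B12.RunParams) (g : ℕ → ℝ)
    (Γr : ℕ → Set (Site (F.P p.K) 0) → Set (Site (F.P p.K) 0)) (Z : TkResidualW F N V p.K) : Prop :=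
  ∀ (j : ℕ) (Y : Set (Site (F.P p.K) 0)) (ω : MultiCfg (F.P p.K) (SU N) V),
    Z.ζ0 j Y ω ≠ 0 → PlaqSmallOn (plaqsOf (pts j (Γr j Y))) (cR * epsOfRecord ν g j) (ω j).1

variable (F : T4Family) (p : B12.RunParams)

/-- **PRINT'S READING REGIONS as a selector**: for a top domain `Ω₀` ([15] p.277 (1): «Ω₀ ⊇ Ω₁ ⊇ … ⊇ Ω_k», [III] p.255: Ω₁ «including a layer of
M₁-cubes … its support» — node00-def-R's `suppDomOfRecord`, here a free set) and the sequence `{Ω_j}_{j ≥ 1}`, the selector `Γr j Y := Y ∩ Ω_j` with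
`Ω_0 := Ω₀`.  At 11a's generation argument `Y = Ω^c_{j+1}` it returns `Λ₀ = Ω₀∖Ω₁` for `j = 0` ([15] (3) «Λ_j ⊆ Ω_j∖Ω_{j+1}») and `Γ_j = Ω_j∖Ω_{j+1}` =
r12's `gammaRegion Ω n j` for `1 ≤ j < n` ([III] (2.2) p.255, (2.10) p.256) — the regions on which Theorem 1 [15] (7) reads the retained variables, and
NOTHING beyond `Ω₀`. [cite: Balaban1985Variational, (1),(3) p.277–278; Balaban1988Convergent, (2.2) p.255, (2.10) p.256] -/
def readSelOfSeq (Ω₀ : Set (Site (F.P p.K) 0)) (Ω : ℕ → Set (Site (F.P p.K) 0)) (j : ℕ) (Y : Set (Site (F.P p.K) 0)) : Set (Site (F.P p.K) 0) :=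
  Y ∩ (if j = 0 then Ω₀ else Ω j)

variable {F p}

/-- The reading region lies in `Y`. [cite: Balaban1988Convergent, (2.2) p.255 (bookkeeping)] -/
theorem readSelOfSeq_subset (Ω₀ : Set (Site (F.P p.K) 0)) (Ω : ℕ → Set (Site (F.P p.K) 0)) (j : ℕ) (Y : Set (Site (F.P p.K) 0)) :
    readSelOfSeq F p Ω₀ Ω j Y ⊆ Y := Set.inter_subset_left

/-- AT SCALE 0 and `Y = Ω₁ᶜ` the reading region is `Λ₀ = Ω₀∖Ω₁` — the collar, NOT all of `Ω₁ᶜ` (FINDING №7). [cite: Balaban1985Variational, (3) p.278; Balaban1988Convergent, p.255] -/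
theorem readSelOfSeq_zero_compl (Ω₀ : Set (Site (F.P p.K) 0)) (Ω : ℕ → Set (Site (F.P p.K) 0)) :
    readSelOfSeq F p Ω₀ Ω 0 (Ω 1)ᶜ = Ω₀ \ Ω 1 := by
  ext x; simp only [readSelOfSeq, Set.mem_inter_iff, Set.mem_compl_iff, Set.mem_sdiff]; exact and_comm

/-- AT SCALES `1 ≤ j < n` and `Y = Ω^c_{j+1}` the reading region is r12's `Γ_j = gammaRegion Ω n j = Ω_j∖Ω_{j+1}` ((2.2); ref-H WATCH-8: the p.264
consequence-cut lives on `Γ_j`, not on all of `Ω^c_{j+1}`). [cite: Balaban1988Convergent, (2.2) p.255, (2.10) p.256, p.264] -/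
theorem readSelOfSeq_compl_eq_gammaRegion (Ω₀ : Set (Site (F.P p.K) 0)) (Ω : ℕ → Set (Site (F.P p.K) 0)) {n j : ℕ} (hj : 0 < j) (hjn : j < n) :
    readSelOfSeq F p Ω₀ Ω j (Ω (j + 1))ᶜ = gammaRegion Ω n j := by
  ext x
  unfold readSelOfSeq gammaRegion
  rw [if_neg (Nat.pos_iff_ne_zero.mp hj), if_neg (not_lt.mpr hjn.le), if_neg (Nat.ne_of_lt hjn), if_neg (Nat.pos_iff_ne_zero.mp hj)]
  simp only [Set.mem_inter_iff, Set.mem_compl_iff]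
  exact and_comm

variable {N : ℕ} [NeZero N] {V : Type} {ν : Stage7Numerics} {cR : ℝ} {g : ℕ → ℝ}

/-- A SMALLER READING REGION IS IMPLIED (`plaqsOf ∘ pts` is monotone). [cite: Balaban1985RegularSpaces, p.77 (bookkeeping)] -/
theorem TkResidualW.RegOn.mono {Γr Γr' : ℕ → Set (Site (F.P p.K) 0) → Set (Site (F.P p.K) 0)} (hle : ∀ j Y, Γr' j Y ⊆ Γr j Y)
    {Z : TkResidualW F N V p.K} (h : Z.RegOn F N V ν cR p g Γr) : Z.RegOn F N V ν cR p g Γr' :=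
  fun j Y ω hζ q hq => h j Y ω hζ q (plaqsOf_mono (Set.preimage_mono (hle j Y)) hq)

/-- The law on all of `Y` (12a's reading region) implies the law on print's reading regions. [cite: Balaban1988Convergent, (2.2) p.255 (bookkeeping)] -/
theorem TkResidualW.RegOn.readSel_of_id {Z : TkResidualW F N V p.K} (h : Z.RegOn F N V ν cR p g fun _ Y => Y)
    (Ω₀ : Set (Site (F.P p.K) 0)) (Ω : ℕ → Set (Site (F.P p.K) 0)) : Z.RegOn F N V ν cR p g (readSelOfSeq F p Ω₀ Ω) :=
  h.mono fun j Y => readSelOfSeq_subset Ω₀ Ω j Y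

/-- **SUPPORT READING OF 12a″**: a non-zero print-`ζ_j(Y)` gives the regularity of the retained scale-`j` variables ON THE READING REGION `Γr j Y` — from the
displayed law, not from a factor. [cite: Balaban1988Convergent, (2.10) p.256, (1.11) p.248] -/
theorem plaqSmallOn_of_zetaWtP_ne_zero {Γr : ℕ → Set (Site (F.P p.K) 0) → Set (Site (F.P p.K) 0)} {Z : TkResidualW F N V p.K}
    (hZ : Z.RegOn F N V ν cR p g Γr) {j : ℕ} {Y : Set (Site (F.P p.K) 0)} {ω : MultiCfg (F.P p.K) (SU N) V}
    (h : zetaWtP F N V p Z j Y ω ≠ 0) : PlaqSmallOn (plaqsOf (pts j (Γr j Y))) (cR * epsOfRecord ν g j) (ω j).1 :=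
  hZ j Y ω h

variable [SeminormedAddCommGroup V] {A₁ : ℝ}

/-- **THE T-HALF OF THE JOINT STATEMENT, RELATIVE TO THE READING REGION** (def-R RFACE-11d, re-ranged): along `{Ω_i}`, if the generation-`j` weight
`ζ_j(Ω^c_{j+1})` of 12a″ does not vanish at `ω`, then `(ω j).1` is `(cR·ε_j)`-regular on the plaquettes touching `Γr j (Ω^c_{j+1})` — the region a
re-ranged (1.7)-clause of the class of record reads at scale `j` (node00-def-R's leaf). [cite: Balaban1988Convergent, (2.10) p.256, (2.2) p.255, (2.21) p.258] -/
theorem plaqSmallOn_readOn_of_zetaP_ne_zero {Γr : ℕ → Set (Site (F.P p.K) 0) → Set (Site (F.P p.K) 0)} {Z : TkResidualW F N V p.K}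
    (hZ : Z.RegOn F N V ν cR p g Γr) (Ω : ℕ → Set (Site (F.P p.K) 0)) (j : ℕ) {ω : MultiCfg (F.P p.K) (SU N) V}
    (h : (tkWeightsOfRecordP F N V ν A₁ p g Z).ζ j (Ω (j + 1))ᶜ ω ≠ 0) :
    PlaqSmallOn (plaqsOf (pts j (Γr j (Ω (j + 1))ᶜ))) (cR * epsOfRecord ν g j) (ω j).1 :=
  hZ j _ ω h

/-- Under 12a's reading (`Γr j Y = Y`) the 12a″ support reading recovers 12a's conclusion on `genSet Ω n j` for `j < n` (so nothing 12a's consumers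
proved from `plaqSmallOn_genSet_of_zeta_ne_zero` is lost when the law holds on all of `Y`). [cite: Balaban1988Convergent, (2.2) p.255, (2.10) p.256 (bookkeeping)] -/
theorem plaqSmallOn_genSet_of_zetaP_ne_zero {Z : TkResidualW F N V p.K} (hZ : Z.RegOn F N V ν cR p g fun _ Y => Y)
    (Ω : ℕ → Set (Site (F.P p.K) 0)) {n j : ℕ} (hj : j < n) {ω : MultiCfg (F.P p.K) (SU N) V}
    (h : (tkWeightsOfRecordP F N V ν A₁ p g Z).ζ j (Ω (j + 1))ᶜ ω ≠ 0) :
    PlaqSmallOn (plaqsOf (genSet Ω n j)) (cR * epsOfRecord ν g j) (ω j).1 :=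
  plaqSmallOn_plaqsOf_mono (genSet_subset_pts_compl Ω hj) (hZ j _ ω h)

end Reading

end Literature.MathematicalPhysics.QuantumFieldTheory.Balaban1983to89.Node00

end
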